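import Literature.MathematicalPhysics.QuantumLattice.SymbolCertificate
import Literature.MathematicalPhysics.QuantumLattice.SectorEigenvalueContinuation
import HarnessLib

/-!
# Route `FunctionFieldCertificate` — support item `NecessaryPoleOrder`
# (stmt-HubbardSuperconductivity-7792): the twisted evaluation of a symbol certificate

The necessary-pole lemma of the route (card `function-field-kkt-certificates` K2) evaluates the
operator identity of a function-field certificate `c : TorusSymbolCertificate M deg p a`,
`M_L - a·1 = Σ s O†O + Σ a Q†[H,Q] + [H,R] + T + E`, NOT in a sector ground state `ψ` (where
every right-hand channel is `≥ 0`, `≥ 0`, `= 0`, `= 0`, `≥ -C/L`: soundness) but in a TWISTED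
state `Vψ`, `V` a sector-preserving unitary (for the route: the `U(1)` twist
`U_j = exp(2πi j Σ_x x₁ n_x / L)`), "conjugating the CONSTRAINT rather than the state": with the
twist cost `D := Vᴴ H V - H` (`O(j/L)` per bond for the Lieb–Schultz–Mattis twist) and the
conjugated generators `Q_V := Vᴴ Q V`, `R_V := Vᴴ R V`, which are again sector preserving, one
gets the model-independent inequality `symbolCertificate_twisted_order_expectation_ge`:

`a - C/L + Σ_{(Q,a) ∈ kkt} Σ_κ Re a(κ) · Re ⟨Q_V ψ, [D, Q_V] ψ⟩ + Re ⟨ψ, [D, R_V] ψ⟩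
  ≤ Re ⟨Vψ, M_L Vψ⟩`.

The two correction terms are the TWIST DEFECTS of the KKT channel and of the `R`-channel: the
SOS channel is `≥ 0` in any state (`ffc_re_sosSum_expectation_nonneg`), the sector term vanishes
on `Vψ ∈ K_L`, the error is `≥ -C/L`, each KKT term is at least its defect because
`⟨Q_Vψ, (H - E₀) Q_Vψ⟩ ≥ 0` (`ffc_re_twistDefect_le_re_kkt_expectation`), and the `R`-channel IS
its defect since `⟨ψ, [H, R_V] ψ⟩ = 0` (`ffc_rch_twisted_expectation_eq`). At `V = 1` the defects
vanish and the inequality is the soundness bound `a - C/L ≤ Re ⟨ψ, M_L ψ⟩`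
(`symbolCertificate_order_expectation_ge`). Unitarity is phrased on vectors (`Vᴴ (V x) = x`, `V (Vᴴ x) = x`)
so that no `DecidableEq` instance of `1` enters the hypotheses.

This is the first, model-independent step of the route's proof sketch of `NecessaryPoleOrder`;
the Hubbard instance (gauge twists `orbitalPhase g` of `(N_L, S^z = 0)`-sector ground states
of `hubbardTorus 2 L 1 U`) is the companion file
`FunctionFieldCertificateNecessaryPoleOrderHubbardTwist.lean`; the model-specific remaining
steps — the `O(j/L)` bounds on the defects of graded symbol-class families under `U_j` and the
pigeonhole bound `Re ⟨U_jψ, M_L U_jψ⟩ ≤ a/2` from the pair sum rule — are not here. Everything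
is finite-dimensional linear algebra over the fields of
`Literature.MathematicalPhysics.QuantumLattice.TorusSymbolCertificate`; no definition is
introduced.

References: route thesis `Theses/FunctionFieldCertificate.lean` (item 7792; sibling
GSCertificate item 0407); E. H. Lieb, T. Schultz, D. Mattis, Ann. Phys. 16 (1961) 407 and
T. Koma, H. Tasaki, J. Stat. Phys. 76 (1994) 745 (twists, low-lying states); Wang et al. 2024,
Fawzi–Fawzi–Scalet 2024 (KKT = first-order ground-state constraints).
-/

namespace Summit.HubbardSuperconductivity.HubbardSuperconductivity.Theorems

-- the problem namespace `HubbardSuperconductivity.HubbardSuperconductivity` is the tree's layout (D-0017)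
set_option linter.dupNamespace false

open Matrix Finset Literature.MathematicalPhysics.QuantumLattice Literature.Probability.LatticeModels
open scoped ComplexOrder ComplexConjugate

/-! ### Linear-algebra bookkeeping -/

section LinAlg

variable {ι : Type*} [Fintype ι]

/-- The expectation of a list sum of matrices is the list sum of the expectations. [folklore] -/
theorem ffc_star_dotProduct_listSum_mulVec (l : List (Matrix ι ι ℂ)) (φ ψ : ι → ℂ) :
    star φ ⬝ᵥ l.sum *ᵥ ψ = (l.map fun A => star φ ⬝ᵥ A *ᵥ ψ).sum := by
  induction l with
  | nil => simp
  | cons A l ih => rw [List.sum_cons, add_mulVec, dotProduct_add, ih, List.map_cons, List.sum_cons]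

/-- A pointwise lower bound on the real parts of the terms bounds the real part of a list sum from
below. [folklore] -/
theorem ffc_listSum_map_le_re_listSum_map {α : Type*} (l : List α) (f : α → ℂ) (g : α → ℝ)
    (h : ∀ x ∈ l, g x ≤ (f x).re) : (l.map g).sum ≤ ((l.map f).sum).re := by
  induction l with
  | nil => simp
  | cons x l ih =>
    rw [List.map_cons, List.sum_cons, List.map_cons, List.sum_cons, Complex.add_re]
    exact add_le_add (h x (List.mem_cons_self)) (ih fun y hy => h y (List.mem_cons_of_mem x hy))

/-- `⟨φ, Aᴴ B ψ⟩ = ⟨A φ, B ψ⟩`. [folklore] -/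
theorem ffc_star_dotProduct_conjTranspose_mul_mulVec (A B : Matrix ι ι ℂ) (φ ψ : ι → ℂ) :
    star φ ⬝ᵥ (Aᴴ * B) *ᵥ ψ = star (A *ᵥ φ) ⬝ᵥ B *ᵥ ψ := by
  rw [← mulVec_mulVec, dotProduct_mulVec, star_mulVec]

/-- `⟨φ, Aᴴ x⟩ = ⟨A φ, x⟩`. [folklore] -/
theorem ffc_star_dotProduct_conjTranspose_mulVec (A : Matrix ι ι ℂ) (φ x : ι → ℂ) :
    star φ ⬝ᵥ Aᴴ *ᵥ x = star (A *ᵥ φ) ⬝ᵥ x := by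
  rw [dotProduct_mulVec, star_mulVec]

/-- For a co-isometry `V` (`V Vᴴ = 1`, written on vectors to stay free of the `DecidableEq`
instance of `1`): `⟨Vᴴ φ, Vᴴ ψ⟩ = ⟨φ, ψ⟩`. [folklore] -/
theorem ffc_star_conjTranspose_mulVec_dotProduct_conjTranspose_mulVec {V : Matrix ι ι ℂ}
    (hV : ∀ x, V *ᵥ (Vᴴ *ᵥ x) = x) (φ ψ : ι → ℂ) :
    star (Vᴴ *ᵥ φ) ⬝ᵥ Vᴴ *ᵥ ψ = star φ ⬝ᵥ ψ := by
  rw [star_mulVec, conjTranspose_conjTranspose, ← dotProduct_mulVec, hV]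

/-- For an isometry `V` (`Vᴴ V = 1`, written on vectors): `⟨V φ, V ψ⟩ = ⟨φ, ψ⟩`. [folklore] -/
theorem ffc_star_mulVec_dotProduct_mulVec_of_isometry {V : Matrix ι ι ℂ}
    (hV : ∀ x, Vᴴ *ᵥ (V *ᵥ x) = x) (φ ψ : ι → ℂ) :
    star (V *ᵥ φ) ⬝ᵥ V *ᵥ ψ = star φ ⬝ᵥ ψ := by
  rw [star_mulVec, ← dotProduct_mulVec, hV]

/-- For a Hermitian `H` and an eigenvector `H ψ = E₀ ψ` with `E₀` real: `⟨ψ, H φ⟩ = E₀ ⟨ψ, φ⟩`.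
[folklore] -/
theorem ffc_star_dotProduct_mulVec_of_eigenvector_left {H : Matrix ι ι ℂ} (hH : H.IsHermitian)
    {ψ : ι → ℂ} {E₀ : ℝ} (hψ : H *ᵥ ψ = (E₀ : ℂ) • ψ) (φ : ι → ℂ) :
    star ψ ⬝ᵥ H *ᵥ φ = (E₀ : ℂ) * (star ψ ⬝ᵥ φ) := by
  rw [dotProduct_mulVec, ← hH.eq, ← star_mulVec, hψ, star_smul, smul_dotProduct,
    Complex.star_def, Complex.conj_ofReal, smul_eq_mul]

/-- The real part of `w • z` for a real nonnegative weight written as a complex number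
(`w.im = 0`) is `w.re * z.re`. [folklore] -/
theorem ffc_re_mul_of_im_eq_zero {w : ℂ} (hw : w.im = 0) (z : ℂ) : (w * z).re = w.re * z.re := by
  rw [Complex.mul_re, hw, zero_mul, sub_zero]

end LinAlg

/-! ### The twisted evaluation of a symbol certificate -/

section Twist

variable {d : ℕ} {M : MomentumModel d} {deg p : ℕ} {a : ℝ}

/-- **SOS channel in any state.** For a list of weighted families with real nonnegative weights,
`Re ⟨φ, (Σ_j Σ_κ s_j(κ) O_j(κ)ᴴ O_j(κ)) φ⟩ ≥ 0` for EVERY vector `φ`. [folklore] -/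
theorem ffc_re_sosSum_expectation_nonneg (l : List (WeightedSymbolOp M.Letter d))
    (hl : ∀ F ∈ l, F.WeightNonneg) (L : ℕ) [NeZero L] (φ : M.idx L → ℂ) :
    0 ≤ (star φ ⬝ᵥ sosSum M l L *ᵥ φ).re := by
  unfold sosSum
  rw [ffc_star_dotProduct_listSum_mulVec, List.map_map]
  have h := ffc_listSum_map_le_re_listSum_map l
    ((fun A => star φ ⬝ᵥ A *ᵥ φ) ∘ fun F => ∑ κ : Fin F.arity → TorusSite d L,
      F.weight.eval L κ • ((F.op.eval M L κ)ᴴ * F.op.eval M L κ)) (fun _ => 0) ?_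
  · simpa using h
  intro F hF
  simp only [Function.comp_apply, sum_mulVec, dotProduct_sum, Complex.re_sum]
  refine Finset.sum_nonneg fun κ _ => ?_
  rw [smul_mulVec, dotProduct_smul, smul_eq_mul, ffc_re_mul_of_im_eq_zero ((hl F hF) L κ).2,
    ffc_star_dotProduct_conjTranspose_mul_mulVec]
  exact mul_nonneg ((hl F hF) L κ).1 (EigenvalueContinuation.re_star_dotProduct_self_nonneg _)

end Twist

section Conjugation

variable {ι : Type*} [Fintype ι]

/-- Conjugated operators act through `V`: `(Vᴴ X V) ψ = Vᴴ (X (V ψ))`. [folklore] -/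
theorem ffc_conj_mulVec (V X : Matrix ι ι ℂ) (ψ : ι → ℂ) :
    (Vᴴ * X * V) *ᵥ ψ = Vᴴ *ᵥ (X *ᵥ (V *ᵥ ψ)) := by
  rw [mulVec_mulVec, mulVec_mulVec]

/-- The twisted Hamiltonian on the twisted eigenvector: from `Vᴴ H V = H + D`, `V Vᴴ = 1` and
`H ψ = E₀ ψ`, `H (Vψ) = E₀ Vψ + V D ψ`. [folklore] -/
theorem ffc_mulVec_twist_of_eigenvector {H V D : Matrix ι ι ℂ} (hVr : ∀ x, V *ᵥ (Vᴴ *ᵥ x) = x)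
    (hD : Vᴴ * H * V = H + D) {ψ : ι → ℂ} {E₀ : ℝ} (hHψ : H *ᵥ ψ = (E₀ : ℂ) • ψ) :
    H *ᵥ (V *ᵥ ψ) = (E₀ : ℂ) • (V *ᵥ ψ) + V *ᵥ (D *ᵥ ψ) := by
  have h := congrArg (fun X => V *ᵥ (X *ᵥ ψ)) hD
  simp only [ffc_conj_mulVec, hVr, add_mulVec, mulVec_add] at h
  rw [h, hHψ, mulVec_smul]

/-- The twist cost on a conjugated vector: `D (Vᴴ x) = Vᴴ (H x) - H (Vᴴ x)`. [folklore] -/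
theorem ffc_twistCost_mulVec {H V D : Matrix ι ι ℂ} (hVr : ∀ x, V *ᵥ (Vᴴ *ᵥ x) = x)
    (hD : Vᴴ * H * V = H + D) (x : ι → ℂ) :
    D *ᵥ (Vᴴ *ᵥ x) = Vᴴ *ᵥ (H *ᵥ x) - H *ᵥ (Vᴴ *ᵥ x) := by
  have hDdef : D = Vᴴ * H * V - H := by rw [hD]; abel
  rw [hDdef, sub_mulVec, ffc_conj_mulVec, hVr]

/-- **KKT channel, one constraint: conjugate the constraint, not the state.** Let `H` be Hermitian,
`V` unitary with twist cost `D` (`Vᴴ H V = H + D`), `ψ` an eigenvector `H ψ = E₀ ψ` which is a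
ground state of `H` in the subspace `K` (variational inequality `hmin`), and `Q` a matrix whose
conjugate `Q_V = Vᴴ Q V` maps `ψ` into `K`. Then the KKT expectation in the twisted state `Vψ`
is bounded below by the twist defect:
`Re ⟨Q_V ψ, [D, Q_V] ψ⟩ ≤ Re ⟨Vψ, Qᴴ (H Q - Q H) Vψ⟩`,
the difference being `⟨Q_V ψ, (H - E₀) Q_V ψ⟩ ≥ 0`. [folklore] -/
theorem ffc_re_twistDefect_le_re_kkt_expectation {H V D Q : Matrix ι ι ℂ}
    (hVr : ∀ x, V *ᵥ (Vᴴ *ᵥ x) = x) (hD : Vᴴ * H * V = H + D)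
    (K : Submodule ℂ (ι → ℂ)) {ψ : ι → ℂ} {E₀ : ℝ} (hHψ : H *ᵥ ψ = (E₀ : ℂ) • ψ)
    (hmin : ∀ φ ∈ K, E₀ * (star φ ⬝ᵥ φ).re ≤ (star φ ⬝ᵥ H *ᵥ φ).re)
    (hQVψ : (Vᴴ * Q * V) *ᵥ ψ ∈ K) :
    (star ((Vᴴ * Q * V) *ᵥ ψ) ⬝ᵥ (D * (Vᴴ * Q * V) - (Vᴴ * Q * V) * D) *ᵥ ψ).re ≤
      (star (V *ᵥ ψ) ⬝ᵥ (Qᴴ * (H * Q - Q * H)) *ᵥ (V *ᵥ ψ)).re := by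
  -- notation: `φ = Vψ`, `w = Q φ`, `u = Q_V ψ = Vᴴ w`
  have hHφ := ffc_mulVec_twist_of_eigenvector hVr hD hHψ
  have hu : (Vᴴ * Q * V) *ᵥ ψ = Vᴴ *ᵥ (Q *ᵥ (V *ᵥ ψ)) := ffc_conj_mulVec V Q ψ
  -- the KKT operator on `φ`
  have e1 : (H * Q - Q * H) *ᵥ (V *ᵥ ψ) =
      H *ᵥ (Q *ᵥ (V *ᵥ ψ)) - (E₀ : ℂ) • (Q *ᵥ (V *ᵥ ψ)) - Q *ᵥ (V *ᵥ (D *ᵥ ψ)) := by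
    rw [sub_mulVec, ← mulVec_mulVec, ← mulVec_mulVec, hHφ, mulVec_add, mulVec_smul]
    abel
  -- the defect operator on `ψ`
  have e2 : (D * (Vᴴ * Q * V) - (Vᴴ * Q * V) * D) *ᵥ ψ =
      Vᴴ *ᵥ (H *ᵥ (Q *ᵥ (V *ᵥ ψ))) - H *ᵥ (Vᴴ *ᵥ (Q *ᵥ (V *ᵥ ψ))) -
        Vᴴ *ᵥ (Q *ᵥ (V *ᵥ (D *ᵥ ψ))) := by
    rw [sub_mulVec, ← mulVec_mulVec ψ D, hu, ffc_twistCost_mulVec hVr hD,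
      ← mulVec_mulVec ψ (Vᴴ * Q * V) D, ffc_conj_mulVec]
  rw [e2, hu, ffc_star_dotProduct_conjTranspose_mul_mulVec, e1]
  simp only [dotProduct_sub, dotProduct_smul, smul_eq_mul, Complex.sub_re,
    Complex.re_ofReal_mul]
  rw [ffc_star_dotProduct_conjTranspose_mulVec, ffc_star_dotProduct_conjTranspose_mulVec, hVr]
  -- the gap term `⟨u, H u⟩ - E₀ ⟨u, u⟩ ≥ 0`, `⟨u, u⟩ = ⟨w, w⟩`
  have hgap := hmin _ hQVψ
  rw [hu, ffc_star_conjTranspose_mulVec_dotProduct_conjTranspose_mulVec hVr] at hgap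
  linarith

/-- **`R`-channel: the commutator expectation in the twisted state is a pure twist defect.** With
the notation of `ffc_re_twistDefect_le_re_kkt_expectation` and `R_V = Vᴴ R V`:
`⟨Vψ, (H R - R H) Vψ⟩ = ⟨ψ, (D R_V - R_V D) ψ⟩` (exactly, as complex numbers), because
`⟨ψ, (H R_V - R_V H) ψ⟩ = 0` for the eigenvector `ψ` of the Hermitian `H`. [folklore] -/
theorem ffc_rch_twisted_expectation_eq {H V D R : Matrix ι ι ℂ}
    (hH : H.IsHermitian) (hVr : ∀ x, V *ᵥ (Vᴴ *ᵥ x) = x) (hD : Vᴴ * H * V = H + D)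
    {ψ : ι → ℂ} {E₀ : ℝ} (hHψ : H *ᵥ ψ = (E₀ : ℂ) • ψ) :
    star (V *ᵥ ψ) ⬝ᵥ (H * R - R * H) *ᵥ (V *ᵥ ψ) =
      star ψ ⬝ᵥ (D * (Vᴴ * R * V) - (Vᴴ * R * V) * D) *ᵥ ψ := by
  have hHφ := ffc_mulVec_twist_of_eigenvector hVr hD hHψ
  have hVD : V *ᵥ (D *ᵥ ψ) = H *ᵥ (V *ᵥ ψ) - (E₀ : ℂ) • (V *ᵥ ψ) := by rw [hHφ]; abel
  have hr : (Vᴴ * R * V) *ᵥ ψ = Vᴴ *ᵥ (R *ᵥ (V *ᵥ ψ)) := ffc_conj_mulVec V R ψ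
  -- left side: `⟨φ, H R φ⟩ - ⟨φ, R H φ⟩`
  have e1 : (H * R - R * H) *ᵥ (V *ᵥ ψ) =
      H *ᵥ (R *ᵥ (V *ᵥ ψ)) - (E₀ : ℂ) • (R *ᵥ (V *ᵥ ψ)) - R *ᵥ (V *ᵥ (D *ᵥ ψ)) := by
    rw [sub_mulVec, ← mulVec_mulVec, ← mulVec_mulVec, hHφ, mulVec_add, mulVec_smul]
    abel
  -- right side
  have e2 : (D * (Vᴴ * R * V) - (Vᴴ * R * V) * D) *ᵥ ψ =
      Vᴴ *ᵥ (H *ᵥ (R *ᵥ (V *ᵥ ψ))) - H *ᵥ (Vᴴ *ᵥ (R *ᵥ (V *ᵥ ψ))) -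
        Vᴴ *ᵥ (R *ᵥ (V *ᵥ (D *ᵥ ψ))) := by
    rw [sub_mulVec, ← mulVec_mulVec ψ D, hr, ffc_twistCost_mulVec hVr hD,
      ← mulVec_mulVec ψ (Vᴴ * R * V) D, ffc_conj_mulVec]
  rw [e1, e2]
  simp only [dotProduct_sub, dotProduct_smul, smul_eq_mul]
  rw [ffc_star_dotProduct_conjTranspose_mulVec, ffc_star_dotProduct_conjTranspose_mulVec,
    ffc_star_dotProduct_mulVec_of_eigenvector_left hH hHψ, ffc_star_dotProduct_conjTranspose_mulVec]

end Conjugation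

section Evaluation

variable {d : ℕ} {M : MomentumModel d} {deg p : ℕ} {a : ℝ}

/-- **The twisted evaluation of a symbol certificate.** Let `c : TorusSymbolCertificate M deg p a`,
`L ≥ L₀` even, `H_L` Hermitian, `V` a unitary preserving the sector `K_L` together with `Vᴴ`, with
twist cost `D` (`Vᴴ H_L V = H_L + D`), and `ψ ∈ K_L` a normalised sector ground state
(`H_L ψ = E₀ ψ`, `E₀ ‖φ‖² ≤ Re ⟨φ, H_L φ⟩` on `K_L`). Evaluating the certificate's identity in the
twisted state `Vψ` and conjugating every constraint back to `ψ` gives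
`a - C/L + Σ_{(Q,a) ∈ kkt} Σ_κ Re a(κ) · Re ⟨Q_V ψ, [D, Q_V] ψ⟩ + Re ⟨ψ, [D, R_V] ψ⟩ ≤ Re ⟨Vψ, M_L Vψ⟩`
(`Q_V = Vᴴ Q(κ) V`, `R_V = Vᴴ R_L V`): the SOS channel is `≥ 0` in any state, the sector term
vanishes on `Vψ ∈ K_L`, the error is `≥ -C/L`, each KKT term is at least its twist defect
(`ffc_re_twistDefect_le_re_kkt_expectation`) and the `R`-channel IS its twist defect
(`ffc_rch_twisted_expectation_eq`). This is the model-independent first step of the route's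
necessary-pole lemma (item stmt-HubbardSuperconductivity-7792): a certificate whose channels have
twist defects `o(1)` as `L → ∞` under the `U(1)` twists `U_j`, `j ≤ J₀(a)`, would force
`Re ⟨U_jψ, M_L U_jψ⟩ ≥ a - o(1)` for all of them, which the pair sum rule forbids. [folklore] -/
theorem symbolCertificate_twisted_order_expectation_ge (c : TorusSymbolCertificate M deg p a) (L : ℕ) [NeZero L]
    (hL : c.L₀ ≤ L) (hE : Even L) (hH : (M.ham L).IsHermitian)
    {V D : Matrix (M.idx L) (M.idx L) ℂ} (hVl : ∀ x, Vᴴ *ᵥ (V *ᵥ x) = x)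
    (hVr : ∀ x, V *ᵥ (Vᴴ *ᵥ x) = x) (hD : Vᴴ * M.ham L * V = M.ham L + D)
    (hVK : ∀ φ ∈ M.sector L, V *ᵥ φ ∈ M.sector L)
    (hVK' : ∀ φ ∈ M.sector L, Vᴴ *ᵥ φ ∈ M.sector L)
    {ψ : M.idx L → ℂ} (hψK : ψ ∈ M.sector L) (hψ1 : star ψ ⬝ᵥ ψ = 1) {E₀ : ℝ}
    (hHψ : M.ham L *ᵥ ψ = (E₀ : ℂ) • ψ)
    (hmin : ∀ φ ∈ M.sector L, E₀ * (star φ ⬝ᵥ φ).re ≤ (star φ ⬝ᵥ M.ham L *ᵥ φ).re) :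
    a - c.C / L
      + (c.kkt.map fun F => ∑ κ : Fin F.arity → TorusSite d L, (F.weight.eval L κ).re *
          (star ((Vᴴ * F.op.eval M L κ * V) *ᵥ ψ) ⬝ᵥ
            (D * (Vᴴ * F.op.eval M L κ * V) - (Vᴴ * F.op.eval M L κ * V) * D) *ᵥ ψ).re).sum
      + (star ψ ⬝ᵥ (D * (Vᴴ * weightedSum M c.rch L * V) -
          (Vᴴ * weightedSum M c.rch L * V) * D) *ᵥ ψ).re
      ≤ (star (V *ᵥ ψ) ⬝ᵥ M.order L *ᵥ (V *ᵥ ψ)).re := by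
  have hφK : V *ᵥ ψ ∈ M.sector L := hVK ψ hψK
  have hφ1 : star (V *ᵥ ψ) ⬝ᵥ (V *ᵥ ψ) = 1 := by
    rw [ffc_star_mulVec_dotProduct_mulVec_of_isometry hVl, hψ1]
  -- evaluate the identity in `φ = Vψ`
  have hid := congrArg (fun X => star (V *ᵥ ψ) ⬝ᵥ X *ᵥ (V *ᵥ ψ)) (c.identity L hL hE)
  rw [sub_mulVec, dotProduct_sub, smul_mulVec, one_mulVec, dotProduct_smul, hφ1, smul_eq_mul,
    mul_one, add_mulVec, add_mulVec, add_mulVec, add_mulVec, dotProduct_add, dotProduct_add,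
    dotProduct_add, dotProduct_add] at hid
  have hid' := congrArg Complex.re hid
  simp only [Complex.sub_re, Complex.add_re, Complex.ofReal_re] at hid'
  -- SOS channel
  have hsos := ffc_re_sosSum_expectation_nonneg c.sos c.sos_nonneg L (V *ᵥ ψ)
  -- KKT channel
  have hkkt : (c.kkt.map fun F => ∑ κ : Fin F.arity → TorusSite d L, (F.weight.eval L κ).re *
      (star ((Vᴴ * F.op.eval M L κ * V) *ᵥ ψ) ⬝ᵥ
        (D * (Vᴴ * F.op.eval M L κ * V) - (Vᴴ * F.op.eval M L κ * V) * D) *ᵥ ψ).re).sum ≤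
      (star (V *ᵥ ψ) ⬝ᵥ kktSum M c.kkt L *ᵥ (V *ᵥ ψ)).re := by
    unfold kktSum
    rw [ffc_star_dotProduct_listSum_mulVec, List.map_map]
    refine ffc_listSum_map_le_re_listSum_map c.kkt _ _ fun F hF => ?_
    simp only [Function.comp_apply, sum_mulVec, dotProduct_sum, Complex.re_sum]
    refine Finset.sum_le_sum fun κ _ => ?_
    rw [smul_mulVec, dotProduct_smul, smul_eq_mul, ffc_re_mul_of_im_eq_zero ((c.kkt_nonneg F hF) L κ).2]
    refine mul_le_mul_of_nonneg_left ?_ ((c.kkt_nonneg F hF) L κ).1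
    refine ffc_re_twistDefect_le_re_kkt_expectation hVr hD (M.sector L) hHψ hmin ?_
    rw [ffc_conj_mulVec]
    exact hVK' _ (c.kkt_sector F hF L κ _ hφK)
  -- R-channel
  have hrch := congrArg Complex.re
    (ffc_rch_twisted_expectation_eq (R := weightedSum M c.rch L) hH hVr hD hHψ)
  -- sector term and error
  have hT := congrArg Complex.re (c.sectorTerm_null L (V *ᵥ ψ) hφK)
  rw [Complex.zero_re] at hT
  have herr : -(c.C / L) ≤ (star (V *ᵥ ψ) ⬝ᵥ c.error L *ᵥ (V *ᵥ ψ)).re := by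
    have h := (c.error_lower L hL).dotProduct_mulVec_nonneg (V *ᵥ ψ)
    rw [add_mulVec, dotProduct_add, smul_mulVec, one_mulVec, dotProduct_smul, smul_eq_mul, hφ1,
      mul_one] at h
    have h' := (Complex.nonneg_iff.1 h).1
    rw [Complex.add_re, Complex.ofReal_re] at h'
    linarith
  linarith [hid', hsos, hkkt, hrch, herr, hT]

/-- **Soundness of a symbol certificate in every sector ground state** (the case `V = 1` of
`symbolCertificate_twisted_order_expectation_ge`: no twist, no defect): `a - C/L ≤ Re ⟨ψ, M_L ψ⟩` for every
normalised sector ground state `ψ` of a Hermitian `H_L`, `L ≥ L₀` even. [folklore] -/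
theorem symbolCertificate_order_expectation_ge (c : TorusSymbolCertificate M deg p a) (L : ℕ) [NeZero L]
    (hL : c.L₀ ≤ L) (hE : Even L) (hH : (M.ham L).IsHermitian)
    {ψ : M.idx L → ℂ} (hψK : ψ ∈ M.sector L) (hψ1 : star ψ ⬝ᵥ ψ = 1) {E₀ : ℝ}
    (hHψ : M.ham L *ᵥ ψ = (E₀ : ℂ) • ψ)
    (hmin : ∀ φ ∈ M.sector L, E₀ * (star φ ⬝ᵥ φ).re ≤ (star φ ⬝ᵥ M.ham L *ᵥ φ).re) :
    a - c.C / L ≤ (star ψ ⬝ᵥ M.order L *ᵥ ψ).re := by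
  have h := symbolCertificate_twisted_order_expectation_ge c L hL hE hH (V := 1) (D := 0)
    (fun x => by rw [conjTranspose_one, one_mulVec, one_mulVec])
    (fun x => by rw [conjTranspose_one, one_mulVec, one_mulVec])
    (by rw [conjTranspose_one, Matrix.one_mul, Matrix.mul_one, add_zero])
    (fun φ hφ => by rwa [one_mulVec]) (fun φ hφ => by rwa [conjTranspose_one, one_mulVec])
    hψK hψ1 hHψ hmin
  simpa using h

end Evaluation

end Summit.HubbardSuperconductivity.HubbardSuperconductivity.Theorems
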